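import Literature.AlgebraicGeometry.HodgeTheory.QuaternionicQuarticDoublePlaneChart
import Literature.AlgebraicGeometry.HodgeTheory.QuaternionicQuarticPrimeSpecialisation
import HarnessLib

/-!
# The double-plane chart of the quaternionic quartic in the plane coordinates `(s, y = σc)`:
# `(a₀ − a₁)·t² = s·y·(s² − 1)·ψ̃(s, y)` over the affine `(s, y)`-plane (a chart of `𝔽₂`, `E = {y = 0}`)

Layer `Literature/AlgebraicGeometry/HodgeTheory`. Definitions + proved API (no named fact, nothing conditional). Sequel of
`QuaternionicQuarticDoublePlaneChart` (`DoublePlaneRing a = R[u₀, u₁, s, t]/(c − s²σc, t² − sαψ)`, the double cover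
`t² = s·α·ψ` of the rational surface `Q⁺ = {c = s²σc} ⊂ 𝔸³_{u₀,u₁,s}`). Written by the prover seat
`leafhand-hodge-q8symplecticpowers-4` (g4, cell `pub-hsemireg`) for route `HodgeConjecture/Q8SymplecticPowers` (crux K1Q,
stmt-HodgeConjecture-24190), brick **Zb-3 «double-plane bridge»** of the S1 programme (`stub_regularVeryGeneralQ`;
FIFTH-HAND-AUDIT: «ℤ∕4 tower = double cover of 𝔽₂ branched on reduced nodal B = E + f₁ + f₂ + f₃ + f₄ + Ψ̃»).

With `c = a₀x₀ + a₁x₁ + a₂x₂` (`coefLin a j = a_j`), `σc = a₁x₀ + a₀x₁ + a₂x₂`: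

* `c₄_eq`, `c₄'_eq`, `c₄_sub_c₄'` — `c − σc = (a₀ − a₁)·α` (`α = u₀ − u₁`), over any `R`, no hypothesis;
* `mk_C_mul_α₄` — in `DoublePlaneRing a`: `(a₀ − a₁)·α = σc·(s² − 1)` (the branch line `α = 0` of `V` becomes the
  fibres `s = ±1` and the exceptional curve `E = {σc = 0}`); `mk_C_mul_t_sq` — `(a₀ − a₁)·t² = s·σc·(s² − 1)·ψ`:
  the branch curve of the double plane is `E + f₀ + f₊ + f₋ + Ψ̃` in the chart (the fourth fibre `s = ∞` outside) —
  the census configuration;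
* under an inverse `dinv` of `a₀² − a₁²` (the complex points off `{a₀² = a₁²}`, or the ring `A[1/(a₀² − a₁²)]`):
  `planeU₀`, `planeU₁` (the unique `u` with `c(u) = s²y`, `σc(u) = y`), `planeSubst`, `substBack`, `planeRel = F(s,y,t)`,
  `PlaneDoubleRing a dinv = R[s, y, t]/(F)`, and **`doublePlaneRingEquivPlane : DoublePlaneRing a ≃ₐ[R] R[s, y, t]/(F)`**
  (`y ↔ σc`): the double-plane chart IS a double cover of the affine PLANE; `C_mul_planeRel` —
  `(a₀ − a₁)·F = (a₀ − a₁)·t² − s·y·(s² − 1)·ψ(u(s,y))`.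

So, combined with `QuaternionicQuarticDoublePlaneChartEquiv` (`Spec DeckRing → Spec DoublePlaneRing` an open immersion)
and `QuaternionicQuarticDeckChartBirational`, every model of `V_(c,ψ)` with `a₀² ≠ a₁²` is birational to the double plane
`(a₀ − a₁)t² = s·y·(s² − 1)·ψ̃(s,y)` — Zariski's `z² = f(x, y)` — whose desingularisation has `q` equal to a sum of
superabundances (Naie Thm. 3.1; here every term vanishes: S1's residue in print). Honest scope: explicit commutative algebra;
nothing here bears on HC; S1 ∕ K1Q NOT proved here.

## References

* [Naie2007] D. Naie, The irregularity of cyclic multiple planes after Zariski, Enseign. Math. 53 (2007), §1.2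
  (normalization procedure; Example 1: `𝔽ₙ` from the cone point) and Thm. 3.1 [held: paper:arxiv-math_0603427].
* [Zariski1929] O. Zariski, On the linear connection index of the algebraic surfaces zⁿ = f(x, y), PNAS 15 (1929).
* [EsnaultViehweg1982] H. Esnault, E. Viehweg, Revêtements cycliques, LNM 947 (1982), §3 ((3.11): irregularity of
  cyclic multiple planes via superabundance).
* [Kollar2007] J. Kollár, Lectures on Resolution of Singularities (2007), §3.3.
-/

noncomputable section

open MvPolynomial

namespace Literature.AlgebraicGeometry.HodgeTheory.Q8Family

universe v

/-! ### The branch configuration in the coordinates `(s, σc)` -/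
section PlaneForm

variable {R : Type v} [CommRing R] {e : ℕ} (a : CIdx e → R)

/-- The coefficient `a_j` of `x_j` in the linear form `c` (plumbing abbreviation). [cite: Kollar2007, §3.3] -/
abbrev coefLin (j : Fin 3) : R := a (Sum.inl (linIdx j))

/-- `c = a₀u₀ + a₁u₁ + a₂` in `R[u₀, u₁, s, t]`. [cite: Kollar2007, §3.3] -/
theorem c₄_eq : c₄ a = C (coefLin a 0) * X 0 + C (coefLin a 1) * X 1 + C (coefLin a 2) := by
  rw [c₄, cOfR_eq_sum, map_sum, Fin.sum_univ_three]
  simp [dehom₄, coefLin]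

/-- `σc = a₀u₁ + a₁u₀ + a₂` in `R[u₀, u₁, s, t]`. [cite: Kollar2007, §3.3] -/
theorem c₄'_eq : c₄' a = C (coefLin a 0) * X 1 + C (coefLin a 1) * X 0 + C (coefLin a 2) := by
  rw [c₄', cOfR_eq_sum, map_sum, map_sum, Fin.sum_univ_three]
  simp [dehom₄, coefLin, Equiv.swap_apply_of_ne_of_ne]

/-- `c − σc = (a₀ − a₁)·α` (`α = u₀ − u₁`). [cite: Kollar2007, §3.3] -/
theorem c₄_sub_c₄' : c₄ a - c₄' a = C (coefLin a 0 - coefLin a 1) * α₄ := by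
  rw [c₄_eq, c₄'_eq, α₄, map_sub]
  ring

/-- **The line `α = 0` in the coordinates `(s, y = σc)`:** `(a₀ − a₁)·α = σc·(s² − 1)` in the double-plane chart ring
(from `c = s²σc`). So the branch component `α = 0` of the quartic multiple plane becomes the two fibres `s = ±1` and
the exceptional curve `σc = 0`. [cite: Naie2007, §1.2 (normalization procedure) and Example 1] -/
theorem mk_C_mul_α₄ :
    Ideal.Quotient.mk (dpIdeal a) (C (coefLin a 0 - coefLin a 1) * α₄) =
      Ideal.Quotient.mk (dpIdeal a) (c₄' a * (X 2 ^ 2 - 1)) := by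
  rw [← c₄_sub_c₄', Ideal.Quotient.eq]
  exact mem_dpIdeal_of_eq a (u := 1) (u' := 0) (by simp only [dpRel]; ring)

/-- **The double plane in the coordinates `(s, y = σc)`:** `(a₀ − a₁)·t² = s·σc·(s² − 1)·ψ` in the double-plane chart
ring — the branch curve is `E + f₀ + f₊ + f₋ + Ψ̃` (`E = {σc = 0}` the exceptional curve of `𝔽₂`, `f₀, f_± = {s = 0},
{s = ±1}` fibres, the fourth fibre `s = ∞` lying outside the chart, `Ψ̃ = {ψ = 0}`), the configuration of the S1
census. [cite: Naie2007, §1.2 (normalization procedure) and Example 1] [cite: EsnaultViehweg1982, §3] -/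
theorem mk_C_mul_t_sq :
    Ideal.Quotient.mk (dpIdeal a) (C (coefLin a 0 - coefLin a 1) * X 3 ^ 2) =
      Ideal.Quotient.mk (dpIdeal a) (X 2 * c₄' a * (X 2 ^ 2 - 1) * ψ₄ a) := by
  have h1 : Ideal.Quotient.mk (dpIdeal a) (X 3 ^ 2) = Ideal.Quotient.mk (dpIdeal a) (X 2 * α₄ * ψ₄ a) := by
    rw [Ideal.Quotient.eq]
    exact mem_dpIdeal_of_eq a (u := 0) (u' := 1) (by simp only [dpRel]; ring)
  have h2 := mk_C_mul_α₄ a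
  calc Ideal.Quotient.mk (dpIdeal a) (C (coefLin a 0 - coefLin a 1) * X 3 ^ 2)
      = Ideal.Quotient.mk (dpIdeal a) (C (coefLin a 0 - coefLin a 1)) *
          Ideal.Quotient.mk (dpIdeal a) (X 3 ^ 2) := map_mul _ _ _
    _ = Ideal.Quotient.mk (dpIdeal a) (X 2) * Ideal.Quotient.mk (dpIdeal a) (ψ₄ a) *
          Ideal.Quotient.mk (dpIdeal a) (C (coefLin a 0 - coefLin a 1) * α₄) := by
        rw [h1]; simp only [map_mul]; ring
    _ = Ideal.Quotient.mk (dpIdeal a) (X 2 * c₄' a * (X 2 ^ 2 - 1) * ψ₄ a) := by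
        rw [h2]; simp only [map_mul, map_sub, map_pow, map_one]; ring

end PlaneForm

/-! ### The plane coordinates `(s, y = σc)`: `Q⁺ = {c = s²σc} ≅ 𝔸²` when `a₀² − a₁²` is invertible -/

section PlaneCoords

variable {R : Type v} [CommRing R] {e : ℕ} (a : CIdx e → R) (dinv : R)

/-- `u₀(s, y) = (a₀(s²y − a₂) − a₁(y − a₂))/(a₀² − a₁²)` — the unique `u₀` with `c(u) = s²y`, `σc(u) = y`
(variables `s = X 0`, `y = X 1`, `t = X 2` of `R[s, y, t]`; `dinv` an inverse of `a₀² − a₁²`).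
[cite: Naie2007, §1.2 (normalization procedure) and Example 1] -/
def planeU₀ : MvPolynomial (Fin 3) R :=
  C dinv * (C (coefLin a 0) * (X 0 ^ 2 * X 1 - C (coefLin a 2)) - C (coefLin a 1) * (X 1 - C (coefLin a 2)))

/-- `u₁(s, y) = (a₀(y − a₂) − a₁(s²y − a₂))/(a₀² − a₁²)`. [cite: Naie2007, §1.2 (normalization procedure) and Example 1] -/
def planeU₁ : MvPolynomial (Fin 3) R :=
  C dinv * (C (coefLin a 0) * (X 1 - C (coefLin a 2)) - C (coefLin a 1) * (X 0 ^ 2 * X 1 - C (coefLin a 2)))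

/-- The substitution `(u₀, u₁, s, t) ↦ (u₀(s,y), u₁(s,y), s, t)` into the plane ring `R[s, y, t]`.
[cite: Naie2007, §1.2 (normalization procedure) and Example 1] -/
def planeSubst : MvPolynomial (Fin 4) R →ₐ[R] MvPolynomial (Fin 3) R :=
  aeval ![planeU₀ a dinv, planeU₁ a dinv, X 0, X 2]

/-- `planeSubst` on `u₀`. [cite: Naie2007, §1.2 (normalization procedure) and Example 1] -/
@[simp] theorem planeSubst_X0 : planeSubst a dinv (X 0) = planeU₀ a dinv := by simp [planeSubst]
/-- `planeSubst` on `u₁`. [cite: Naie2007, §1.2 (normalization procedure) and Example 1] -/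
@[simp] theorem planeSubst_X1 : planeSubst a dinv (X 1) = planeU₁ a dinv := by simp [planeSubst]
/-- `planeSubst` on `s`. [cite: Naie2007, §1.2 (normalization procedure) and Example 1] -/
@[simp] theorem planeSubst_X2 : planeSubst a dinv (X 2) = X 0 := by simp [planeSubst]
/-- `planeSubst` on `t`. [cite: Naie2007, §1.2 (normalization procedure) and Example 1] -/
@[simp] theorem planeSubst_X3 : planeSubst a dinv (X 3) = X 2 := by simp [planeSubst]

/-- The substitution back, `(s, y, t) ↦ (s, σc, t)`. [cite: Naie2007, §1.2 (normalization procedure) and Example 1] -/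
def substBack : MvPolynomial (Fin 3) R →ₐ[R] MvPolynomial (Fin 4) R :=
  aeval ![X 2, c₄' a, X 3]

/-- `substBack` on `s`. [cite: Naie2007, §1.2 (normalization procedure) and Example 1] -/
@[simp] theorem substBack_X0 : substBack a (X 0) = X 2 := by simp [substBack]
/-- `substBack` on `y`. [cite: Naie2007, §1.2 (normalization procedure) and Example 1] -/
@[simp] theorem substBack_X1 : substBack a (X 1) = c₄' a := by simp [substBack]
/-- `substBack` on `t`. [cite: Naie2007, §1.2 (normalization procedure) and Example 1] -/
@[simp] theorem substBack_X2 : substBack a (X 2) = X 3 := by simp [substBack]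

/-- `u₀(s, σc)` as a polynomial in `u₀, u₁, s`. [cite: Naie2007, §1.2 (normalization procedure) and Example 1] -/
theorem substBack_planeU₀ : substBack a (planeU₀ a dinv) =
    C dinv * (C (coefLin a 0) * (X 2 ^ 2 * c₄' a - C (coefLin a 2)) - C (coefLin a 1) * (c₄' a - C (coefLin a 2))) := by
  simp only [planeU₀, map_mul, map_sub, map_pow, algHom_C, MvPolynomial.algebraMap_eq, substBack_X0, substBack_X1]

/-- `u₁(s, σc)` as a polynomial in `u₀, u₁, s`. [cite: Naie2007, §1.2 (normalization procedure) and Example 1] -/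
theorem substBack_planeU₁ : substBack a (planeU₁ a dinv) =
    C dinv * (C (coefLin a 0) * (c₄' a - C (coefLin a 2)) - C (coefLin a 1) * (X 2 ^ 2 * c₄' a - C (coefLin a 2))) := by
  simp only [planeU₁, map_mul, map_sub, map_pow, algHom_C, MvPolynomial.algebraMap_eq, substBack_X0, substBack_X1]

/-- **The double-plane relation in plane coordinates**: `F(s, y, t) = t² − s·α(u(s,y))·ψ(u(s,y))`, the image of
`t² − sαψ`. [cite: Naie2007, §1.2 (normalization procedure) and Example 1] [cite: Zariski1929] -/
def planeRel : MvPolynomial (Fin 3) R := planeSubst a dinv (dpRel a 1)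

/-- **The double plane over the `(s, y)`-plane**: `R[s, y, t]/(F)`. [cite: Zariski1929]
[cite: Naie2007, §1.2 (normalization procedure) and Example 1] -/
abbrev PlaneDoubleRing : Type v := MvPolynomial (Fin 3) R ⧸ Ideal.span {planeRel a dinv}

variable (hd : (coefLin a 0 ^ 2 - coefLin a 1 ^ 2) * dinv = 1)
include hd

/-- `(a₀² − a₁²)·dinv = 1` inside the plane polynomial ring. [folklore] -/
private theorem C_det_mul_C_dinv :
    ((C (coefLin a 0) ^ 2 - C (coefLin a 1) ^ 2) * C dinv : MvPolynomial (Fin 3) R) = 1 := by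
  rw [← map_pow, ← map_pow, ← map_sub, ← map_mul, hd, map_one]

/-- `(a₀² − a₁²)·dinv = 1` inside `R[u₀, u₁, s, t]`. [folklore] -/
private theorem C_det_mul_C_dinv₄ :
    ((C (coefLin a 0) ^ 2 - C (coefLin a 1) ^ 2) * C dinv : MvPolynomial (Fin 4) R) = 1 := by
  rw [← map_pow, ← map_pow, ← map_sub, ← map_mul, hd, map_one]

/-- `c(u(s,y)) = s²y`. [cite: Naie2007, §1.2 (normalization procedure) and Example 1] -/
theorem planeSubst_c₄ : planeSubst a dinv (c₄ a) = X 0 ^ 2 * X 1 := by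
  have hC := C_det_mul_C_dinv a dinv hd
  rw [c₄_eq]
  simp only [map_add, map_mul, algHom_C, MvPolynomial.algebraMap_eq, planeSubst_X0, planeSubst_X1, planeU₀, planeU₁]
  linear_combination (X 0 ^ 2 * X 1 - C (coefLin a 2)) * hC

/-- `σc(u(s,y)) = y`. [cite: Naie2007, §1.2 (normalization procedure) and Example 1] -/
theorem planeSubst_c₄' : planeSubst a dinv (c₄' a) = X 1 := by
  have hC := C_det_mul_C_dinv a dinv hd
  rw [c₄'_eq]
  simp only [map_add, map_mul, algHom_C, MvPolynomial.algebraMap_eq, planeSubst_X0, planeSubst_X1, planeU₀, planeU₁]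
  linear_combination (X 1 - C (coefLin a 2)) * hC

/-- The relation `c − s²σc` dies in plane coordinates. [cite: Naie2007, §1.2 (normalization procedure) and Example 1] -/
theorem planeSubst_dpRel_zero : planeSubst a dinv (dpRel a 0) = 0 := by
  simp only [dpRel, map_sub, map_mul, map_pow, planeSubst_c₄ a dinv hd, planeSubst_c₄' a dinv hd, planeSubst_X2,
    sub_self]

/-- The double-plane ideal maps into `(F)`. [cite: Naie2007, §1.2 (normalization procedure) and Example 1] -/
theorem dpIdeal_le_comap_planeSubst : dpIdeal a ≤ (Ideal.span {planeRel a dinv}).comap (planeSubst a dinv) := by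
  rw [dpIdeal, Ideal.span_le]
  rintro _ ⟨k, rfl⟩
  fin_cases k
  · change planeSubst a dinv (dpRel a 0) ∈ Ideal.span {planeRel a dinv}
    rw [planeSubst_dpRel_zero a dinv hd]
    exact Ideal.zero_mem _
  · exact Ideal.subset_span rfl

/-- `substBack ∘ planeSubst` is the identity modulo `(c − s²σc, t² − sαψ)`: `u₀(s, σc) ≡ u₀`, `u₁(s, σc) ≡ u₁`.
[cite: Naie2007, §1.2 (normalization procedure) and Example 1] -/
theorem mk_substBack_planeSubst (p : MvPolynomial (Fin 4) R) :
    Ideal.Quotient.mk (dpIdeal a) (substBack a (planeSubst a dinv p)) = Ideal.Quotient.mk (dpIdeal a) p := by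
  have hC := C_det_mul_C_dinv₄ a dinv hd
  change ((Ideal.Quotient.mkₐ R (dpIdeal a)).comp ((substBack a).comp (planeSubst a dinv))) p =
    Ideal.Quotient.mkₐ R (dpIdeal a) p
  congr 1
  refine MvPolynomial.algHom_ext fun i => ?_
  fin_cases i
  · simp only [AlgHom.comp_apply, Ideal.Quotient.mkₐ_eq_mk, Fin.reduceFinMk, planeSubst_X0, substBack_planeU₀,
      Ideal.Quotient.eq]
    refine mem_dpIdeal_of_eq a (u := -(C dinv * C (coefLin a 0))) (u' := 0) ?_
    simp only [dpRel, c₄_eq, c₄'_eq]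
    linear_combination (X 0) * hC
  · simp only [AlgHom.comp_apply, Ideal.Quotient.mkₐ_eq_mk, Fin.reduceFinMk, planeSubst_X1, substBack_planeU₁,
      Ideal.Quotient.eq]
    refine mem_dpIdeal_of_eq a (u := C dinv * C (coefLin a 1)) (u' := 0) ?_
    simp only [dpRel, c₄_eq, c₄'_eq]
    linear_combination (X 1) * hC
  · simp
  · simp

/-- `planeSubst ∘ substBack = id` on `R[s, y, t]`. [cite: Naie2007, §1.2 (normalization procedure) and Example 1] -/
theorem planeSubst_substBack (q : MvPolynomial (Fin 3) R) : planeSubst a dinv (substBack a q) = q := by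
  change ((planeSubst a dinv).comp (substBack a)) q = AlgHom.id R _ q
  congr 1
  refine MvPolynomial.algHom_ext fun i => ?_
  fin_cases i
  · simp
  · simp only [AlgHom.comp_apply, Fin.reduceFinMk, substBack_X1, planeSubst_c₄' a dinv hd, AlgHom.id_apply]
  · simp

/-- `(F)` maps into the double-plane ideal under `substBack`. [cite: Naie2007, §1.2 (normalization procedure) and Example 1] -/
theorem span_planeRel_le_comap_substBack :
    Ideal.span {planeRel a dinv} ≤ (dpIdeal a).comap (substBack a) := by
  rw [Ideal.span_le, Set.singleton_subset_iff]
  change substBack a (planeSubst a dinv (dpRel a 1)) ∈ dpIdeal a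
  rw [← Ideal.Quotient.eq_zero_iff_mem, mk_substBack_planeSubst a dinv hd, Ideal.Quotient.eq_zero_iff_mem]
  exact dpRel_mem_dpIdeal a 1

/-- `DoublePlaneRing a → PlaneDoubleRing a dinv`, `(u₀, u₁, s, t) ↦ (u₀(s,y), u₁(s,y), s, t)`.
[cite: Naie2007, §1.2 (normalization procedure) and Example 1] -/
def toPlane : DoublePlaneRing a →ₐ[R] PlaneDoubleRing a dinv :=
  Ideal.quotientMapₐ (Ideal.span {planeRel a dinv}) (planeSubst a dinv) (dpIdeal_le_comap_planeSubst a dinv hd)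

/-- `PlaneDoubleRing a dinv → DoublePlaneRing a`, `(s, y, t) ↦ (s, σc, t)`.
[cite: Naie2007, §1.2 (normalization procedure) and Example 1] -/
def ofPlane : PlaneDoubleRing a dinv →ₐ[R] DoublePlaneRing a :=
  Ideal.quotientMapₐ (dpIdeal a) (substBack a) (span_planeRel_le_comap_substBack a dinv hd)

/-- **The double-plane chart in plane coordinates**: for `a₀² − a₁²` invertible,
`R[u₀, u₁, s, t]/(c − s²σc, t² − sαψ) ≃ₐ[R] R[s, y, t]/(F)`, `y ↔ σc` — the chart is the double cover `F = 0` of the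
affine `(s, y)`-PLANE. [cite: Zariski1929] [cite: Naie2007, §1.2 (normalization procedure) and Example 1] -/
def doublePlaneRingEquivPlane : DoublePlaneRing a ≃ₐ[R] PlaneDoubleRing a dinv :=
  AlgEquiv.ofAlgHom (toPlane a dinv hd) (ofPlane a dinv hd)
    (by
      refine Ideal.Quotient.algHom_ext R (MvPolynomial.algHom_ext fun i => ?_)
      change toPlane a dinv hd (ofPlane a dinv hd (Ideal.Quotient.mk _ (X i))) = Ideal.Quotient.mk _ (X i)
      change Ideal.Quotient.mk _ (planeSubst a dinv (substBack a (X i))) = _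
      rw [planeSubst_substBack a dinv hd])
    (by
      refine Ideal.Quotient.algHom_ext R (MvPolynomial.algHom_ext fun i => ?_)
      change ofPlane a dinv hd (toPlane a dinv hd (Ideal.Quotient.mk _ (X i))) = Ideal.Quotient.mk _ (X i)
      change Ideal.Quotient.mk _ (substBack a (planeSubst a dinv (X i))) = _
      rw [mk_substBack_planeSubst a dinv hd])

/-- The equivalence on classes: `[p] ↦ [planeSubst p]`. [cite: Naie2007, §1.2 (normalization procedure) and Example 1] -/
theorem doublePlaneRingEquivPlane_mk (p : MvPolynomial (Fin 4) R) :
    doublePlaneRingEquivPlane a dinv hd (Ideal.Quotient.mk (dpIdeal a) p) =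
      Ideal.Quotient.mk (Ideal.span {planeRel a dinv}) (planeSubst a dinv p) := rfl

/-- **The branch form in plane coordinates**: `(a₀ − a₁)·F ≡ (a₀ − a₁)·t² − s·y·(s² − 1)·ψ(u(s,y))`, i.e. the double
plane is `(a₀ − a₁) t² = s·y·(s² − 1)·ψ̃(s, y)` with branch curve `{s = 0} + {y = 0} + {s = ±1} + {ψ̃ = 0}` — the
census configuration `E + f₁ + … + Ψ̃` in the chart. [cite: Naie2007, §1.2 (normalization procedure) and Example 1]
[cite: EsnaultViehweg1982, §3] -/
theorem C_mul_planeRel :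
    C (coefLin a 0 - coefLin a 1) * planeRel a dinv =
      C (coefLin a 0 - coefLin a 1) * X 2 ^ 2 - X 0 * X 1 * (X 0 ^ 2 - 1) * planeSubst a dinv (ψ₄ a) := by
  have h1 : planeSubst a dinv (C (coefLin a 0 - coefLin a 1) * α₄) = X 1 * (X 0 ^ 2 - 1) := by
    rw [← c₄_sub_c₄', map_sub, planeSubst_c₄ a dinv hd, planeSubst_c₄' a dinv hd]
    ring
  simp only [map_mul, map_sub, algHom_C, MvPolynomial.algebraMap_eq] at h1
  simp only [planeRel, dpRel, map_sub, map_pow, map_mul, planeSubst_X3, planeSubst_X2]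
  linear_combination (-(X 0 * planeSubst a dinv (ψ₄ a))) * h1

end PlaneCoords

end Literature.AlgebraicGeometry.HodgeTheory.Q8Family

end
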